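import Literature.NumberTheory.Automorphic.HidaLevelPolynomialAction
import Literature.NumberTheory.Automorphic.HidaLevelDiamondAction
import Mathlib.RingTheory.Artinian.Module
import HarnessLib

/-!
# Ordinary parts of finite modules and the transport of annihilators along level-action maps

Topic `NumberTheory/Automorphic`; namespaces `Literature.NumberTheory.Automorphic.OrdFinite` (generic)
and `Literature.NumberTheory.Automorphic.BigHeckeGLn.TameLevel`; theorems and one `abbrev`
(`LaKills`); no named fact, no `sorry`.

**Generic part** (`OrdFinite`).  For a finite family of commuting endomorphisms `U_v` of a FINITE
module `M`, the "ordinary part" `Ord(M) = ⋂_v ⋂_m U_v^m M` is reached at a finite stage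
(`exists_forall_iInf_range_pow_eq`, Mathlib's `LinearMap.eventually_iInf_range_pow_eq`), every `U_v`
is bijective on it (`bijOn_iInf`), and an intertwining map `Ψ : M → M'` which is surjective up to a
natural number `N` (`∀ y, ∃ x, Ψ x = N • y`) is surjective up to `N` between the ordinary parts
(`exists_mem_iInf_map_eq_nsmul`): the elementary substitute for Hida's idempotent
`e = lim U_p^{n!}` on finite coefficients. [cite: Hida1994AIF, §2 (the idempotent e)]

**Level-action part** (`TameLevel`, `GL₂`, trivial coefficients `ℤ/p^s`, `U` maximal above `p`).
With `LaKills 𝒰 b c s i z`: "`laPolyHom z` kills `laOrd ⊆ H^i(U(b,c), 1; ℤ/p^s)`", for a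
level-action map `Φ` commuting with the operators of all Hida elements:
* `laKills_of_injOn` — `Φ` injective on `laOrd` transports `LaKills` from the target to the source;
* `laKills_mul_C_of_surjOn` — `Φ` hitting `N • laOrd` from `laOrd` transports `LaKills z` at the
  source to `LaKills (C N * z)` at the target; `exists_mem_laOrd_map_eq_nsmul` derives this
  hypothesis from plain surjectivity up to `N` (finite cohomology);
* `laKills_mul_C_of_forall_nsmul_eq_zero` — if `N` kills the whole cohomology group.

[cite: Hida1994AIF, §2–§3] [cite: KhareThorne2017, §6.3–§6.5]

## References

* H. Hida, Ann. Inst. Fourier 44 (1994), §2–3. [Hida1994AIF]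
* C. Khare, J. A. Thorne, Amer. J. Math. 139 (2017), §6.3–6.5. [KhareThorne2017]
-/

noncomputable section

open CategoryTheory IsDedekindDomain Filter
open scoped NumberField

namespace Literature.NumberTheory.Automorphic

/-! ### Generic: ordinary parts of finite modules -/

namespace OrdFinite

variable {R : Type} [CommRing R] {M M' : Type} [AddCommGroup M] [Module R M] [AddCommGroup M']
  [Module R M'] {𝒱 : Type} [Finite 𝒱]

/-- **The ordinary part of a finite module is reached at a finite stage**, uniformly for a finite
family of operators: `∃ n, ∀ v, ⋂ₘ U_v^m M = U_v^n M`. [folklore] -/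
theorem exists_forall_iInf_range_pow_eq [Finite M] (U : 𝒱 → Module.End R M) :
    ∃ n : ℕ, ∀ v, ∀ l, n ≤ l → ⨅ m, LinearMap.range (U v ^ m) = LinearMap.range (U v ^ l) := by
  haveI : IsArtinian R M := isArtinian_of_finite
  have h : ∀ᶠ n in atTop, ∀ v, ⨅ m, LinearMap.range (U v ^ m) = LinearMap.range (U v ^ n) :=
    eventually_all.2 fun v => (U v).eventually_iInf_range_pow_eq
  obtain ⟨n, hn⟩ := eventually_atTop.1 h
  exact ⟨n, fun v l hl => hn l hl v⟩

/-- **`U` is surjective on `⋂ₘ U^m M`** (finite `M`). [folklore] -/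
theorem surjOn_iInf_range_pow [Finite M] (U : Module.End R M) :
    Set.SurjOn U (⨅ m, LinearMap.range (U ^ m) : Submodule R M) (⨅ m, LinearMap.range (U ^ m) : Submodule R M) := by
  obtain ⟨n, hn⟩ := exists_forall_iInf_range_pow_eq (fun _ : Unit => U)
  intro y hy
  have hy' : y ∈ LinearMap.range (U ^ (n + 1)) := by
    rw [← hn () (n + 1) (Nat.le_succ n)]; exact hy
  obtain ⟨x, rfl⟩ := hy'
  refine ⟨(U ^ n) x, ?_, by rw [pow_succ', Module.End.mul_apply]⟩
  rw [SetLike.mem_coe, hn () n le_rfl]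
  exact LinearMap.mem_range_self _ x

/-- **`U` is bijective on `⋂ₘ U^m M`** (finite `M`). [folklore] -/
theorem bijOn_iInf_range_pow [Finite M] (U : Module.End R M) :
    Set.BijOn U (⨅ m, LinearMap.range (U ^ m) : Submodule R M) (⨅ m, LinearMap.range (U ^ m) : Submodule R M) :=
  ((Set.toFinite _).surjOn_iff_bijOn_of_mapsTo (BigHeckeGLn.mapsTo_iInf_range_pow_of_comp_eq rfl)).1
    (surjOn_iInf_range_pow U)

omit [Finite 𝒱] in
/-- For commuting `U_v`, each `U_v` maps `Ord(M) = ⋂_v ⋂ₘ U_v^m M` into itself. [folklore] -/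
theorem mapsTo_iInf (U : 𝒱 → Module.End R M) (hc : ∀ v w, U v * U w = U w * U v) (v : 𝒱) :
    Set.MapsTo (U v) (⨅ w, ⨅ m, LinearMap.range (U w ^ m) : Submodule R M)
      (⨅ w, ⨅ m, LinearMap.range (U w ^ m) : Submodule R M) := by
  intro x hx
  simp only [SetLike.mem_coe, Submodule.mem_iInf] at hx ⊢
  intro w
  have h : U v ∘ₗ U w = U w ∘ₗ U v := by
    rw [← Module.End.mul_eq_comp, ← Module.End.mul_eq_comp, hc v w]
  exact (Submodule.mem_iInf _).1 (BigHeckeGLn.mapsTo_iInf_range_pow_of_comp_eq h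
    ((Submodule.mem_iInf _).2 (hx w)))

omit [Finite 𝒱] in
/-- **For commuting `U_v` on a finite module, each `U_v` is bijective on `Ord(M)`.** [folklore] -/
theorem bijOn_iInf [Finite M] (U : 𝒱 → Module.End R M) (hc : ∀ v w, U v * U w = U w * U v) (v : 𝒱) :
    Set.BijOn (U v) (⨅ w, ⨅ m, LinearMap.range (U w ^ m) : Submodule R M)
      (⨅ w, ⨅ m, LinearMap.range (U w ^ m) : Submodule R M) := by
  refine ((Set.toFinite _).injOn_iff_bijOn_of_mapsTo (mapsTo_iInf U hc v)).1 ?_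
  refine (bijOn_iInf_range_pow (U v)).injOn.mono ?_
  intro x hx
  simp only [SetLike.mem_coe, Submodule.mem_iInf] at hx ⊢
  exact hx v

omit [Finite 𝒱] in
/-- Iterates: `U_v^n` is surjective on `Ord(M)`. [folklore] -/
theorem surjOn_pow_iInf [Finite M] (U : 𝒱 → Module.End R M) (hc : ∀ v w, U v * U w = U w * U v) (v : 𝒱)
    (n : ℕ) :
    Set.SurjOn (U v ^ n) (⨅ w, ⨅ m, LinearMap.range (U w ^ m) : Submodule R M)
      (⨅ w, ⨅ m, LinearMap.range (U w ^ m) : Submodule R M) := by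
  induction n with
  | zero =>
    intro y hy
    exact ⟨y, hy, by rw [pow_zero, Module.End.one_apply]⟩
  | succ n ih =>
    intro y hy
    obtain ⟨y₁, hy₁, rfl⟩ := (bijOn_iInf U hc v).surjOn hy
    obtain ⟨y₂, hy₂, rfl⟩ := ih hy₁
    exact ⟨y₂, hy₂, by rw [pow_succ', Module.End.mul_apply]⟩

/-- **Surjectivity up to `N` passes to the ordinary parts** (finite modules, commuting families,
`Ψ` intertwining): if every `N • y` is a value of `Ψ` then every `N • y` with `y ∈ Ord(M')` is the
value of `Ψ` at some `x ∈ Ord(M)`. [cite: Hida1994AIF, §2] -/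
theorem exists_mem_iInf_map_eq_nsmul [Finite M] [Finite M'] (U : 𝒱 → Module.End R M)
    (U' : 𝒱 → Module.End R M') (hc' : ∀ v w, U' v * U' w = U' w * U' v)
    (hc : ∀ v w, U v * U w = U w * U v) (Ψ : M →ₗ[R] M') (hΨ : ∀ v, Ψ ∘ₗ U v = U' v ∘ₗ Ψ) {N : ℕ}
    (hN : ∀ y, ∃ x, Ψ x = N • y) {y : M'} (hy : y ∈ (⨅ w, ⨅ m, LinearMap.range (U' w ^ m) : Submodule R M')) :
    ∃ x ∈ (⨅ w, ⨅ m, LinearMap.range (U w ^ m) : Submodule R M), Ψ x = N • y := by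
  classical
  obtain ⟨n, hn⟩ := exists_forall_iInf_range_pow_eq U
  -- induction on a finite set of places: preimages in `⋂_{v ∈ S} U_v^n M`
  suffices h : ∀ S : Finset 𝒱, ∀ y ∈ (⨅ w, ⨅ m, LinearMap.range (U' w ^ m) : Submodule R M'),
      ∃ x, (∀ v ∈ S, x ∈ LinearMap.range (U v ^ n)) ∧ Ψ x = N • y by
    haveI := Fintype.ofFinite 𝒱
    obtain ⟨x, hx, hΨ'⟩ := h Finset.univ y hy
    refine ⟨x, ?_, hΨ'⟩
    simp only [Submodule.mem_iInf]
    intro w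
    rw [← Submodule.mem_iInf (fun m => LinearMap.range (U w ^ m)), hn w n le_rfl]
    exact hx w (Finset.mem_univ w)
  intro S
  induction S using Finset.induction_on with
  | empty =>
    intro y _
    obtain ⟨x, hx⟩ := hN y
    exact ⟨x, fun v hv => absurd hv (Finset.notMem_empty v), hx⟩
  | insert v S hvS ih =>
    intro y hy
    obtain ⟨y', hy', rfl⟩ := surjOn_pow_iInf U' hc' v n hy
    obtain ⟨x', hx', hΨx'⟩ := ih y' hy'
    refine ⟨(U v ^ n) x', fun w hw => ?_, ?_⟩
    · rcases Finset.mem_insert.1 hw with rfl | hw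
      · exact LinearMap.mem_range_self _ _
      · obtain ⟨x'', rfl⟩ := hx' w hw
        refine ⟨(U v ^ n) x'', ?_⟩
        rw [← Module.End.mul_apply, ← Module.End.mul_apply, (Commute.pow_pow (hc v w) n n).eq]
    · have h := LinearMap.congr_fun (BigHeckeGLn.comp_pow_eq_pow_comp_of_comp_eq (hΨ v) n) x'
      simp only [LinearMap.coe_comp, Function.comp_apply] at h
      rw [h, hΨx', map_nsmul]

end OrdFinite

/-! ### Level-action: transporting annihilators -/

namespace BigHeckeGLn

namespace TameLevel

open LevelAction

variable {K : Type} [Field K] [NumberField K] {p : ℕ} [Fact p.Prime] (𝒰 : TameLevel 2 K p)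

/-- **`LaKills 𝒰 b c s i z`: `laPolyHom z` kills the ordinary part `laOrd ⊆ H^i(U(b,c), 1; ℤ/p^s)`.**
[cite: Hida1994AIF, §3] -/
abbrev LaKills [Fact 𝒰.IsMaximalAbove] (b c s i : ℕ) (z : MvPolynomial 𝒰.hidaElements ℤ) : Prop :=
  ∀ x ∈ 𝒰.laOrd ℤ b c s i, 𝒰.laPolyHom b c s i z x = 0

section Transport

variable [Fact 𝒰.IsMaximalAbove] {b c s i b' c' s' i' : ℕ}
  (Φ : 𝒰.laCohomology ℤ b c s i →ₗ[ℤ] 𝒰.laCohomology ℤ b' c' s' i')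
  (hΦ : ∀ g ∈ 𝒰.hidaElements, Φ ∘ₗ 𝒰.laHecke ℤ b c s g i = 𝒰.laHecke ℤ b' c' s' g i' ∘ₗ Φ)

include hΦ in
omit [Fact 𝒰.IsMaximalAbove] in
/-- A Hecke-equivariant level-action map carries `laOrd` into `laOrd`. [folklore] -/
theorem mapsTo_laOrd {x : 𝒰.laCohomology ℤ b c s i} (hx : x ∈ 𝒰.laOrd ℤ b c s i) :
    Φ x ∈ 𝒰.laOrd ℤ b' c' s' i' := by
  simp only [laOrd, Submodule.mem_iInf] at hx ⊢
  intro v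
  exact (Submodule.mem_iInf _).1 (mapsTo_iInf_range_pow_of_comp_eq
    (hΦ _ (heckeElement_mem_hidaElements 𝒰 (Or.inr v.2) 1)) ((Submodule.mem_iInf _).2 (hx v)))

include hΦ in
/-- **Transport along a map injective on `laOrd`**: `LaKills` at the target implies `LaKills` at the
source. [cite: Hida1994AIF, §3] -/
theorem laKills_of_injOn (hinj : ∀ x ∈ 𝒰.laOrd ℤ b c s i, Φ x = 0 → x = 0)
    (z : MvPolynomial 𝒰.hidaElements ℤ) (hz : 𝒰.LaKills b' c' s' i' z) : 𝒰.LaKills b c s i z := by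
  intro x hx
  refine hinj _ (𝒰.laPolyHom_apply_mem_laOrd z hx) ?_
  have h := LinearMap.congr_fun (𝒰.comp_laPolyHom_eq Φ hΦ z) x
  simp only [LinearMap.coe_comp, Function.comp_apply] at h
  rw [h]
  exact hz _ (𝒰.mapsTo_laOrd Φ hΦ hx)

include hΦ in
/-- **Transport along a map hitting `N • laOrd` from `laOrd`**: `LaKills z` at the source implies
`LaKills (N z)` at the target. [cite: Hida1994AIF, §3] -/
theorem laKills_mul_C_of_surjOn {N : ℕ}
    (hsurj : ∀ y ∈ 𝒰.laOrd ℤ b' c' s' i', ∃ x ∈ 𝒰.laOrd ℤ b c s i, Φ x = N • y)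
    (z : MvPolynomial 𝒰.hidaElements ℤ) (hz : 𝒰.LaKills b c s i z) :
    𝒰.LaKills b' c' s' i' (MvPolynomial.C (N : ℤ) * z) := by
  intro y hy
  obtain ⟨x, hx, hΦx⟩ := hsurj y hy
  have h := LinearMap.congr_fun (𝒰.comp_laPolyHom_eq Φ hΦ z) x
  simp only [LinearMap.coe_comp, Function.comp_apply] at h
  rw [map_mul, MvPolynomial.C_eq_coe_nat, map_natCast, Module.End.mul_apply, Module.End.natCast_apply,
    ← map_nsmul, ← hΦx, ← h, hz x hx, map_zero]

include hΦ in
/-- **Surjectivity up to `N` passes to `laOrd`** (finite cohomology). [cite: Hida1994AIF, §2] -/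
theorem exists_mem_laOrd_map_eq_nsmul [Finite (𝒰.laCohomology ℤ b c s i)]
    [Finite (𝒰.laCohomology ℤ b' c' s' i')] {N : ℕ} (hN : ∀ y, ∃ x, Φ x = N • y)
    {y : 𝒰.laCohomology ℤ b' c' s' i'} (hy : y ∈ 𝒰.laOrd ℤ b' c' s' i') :
    ∃ x ∈ 𝒰.laOrd ℤ b c s i, Φ x = N • y := by
  have h𝒰 : 𝒰.IsMaximalAbove := Fact.out
  have ht : ∀ v : PlacesAbove K p, heckeElement 2 K v.1 1 ∈ 𝒰.hidaElements := fun v =>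
    heckeElement_mem_hidaElements 𝒰 (Or.inr v.2) 1
  exact OrdFinite.exists_mem_iInf_map_eq_nsmul
    (fun v : PlacesAbove K p => 𝒰.laHecke ℤ b c s (heckeElement 2 K v.1 1) i)
    (fun v : PlacesAbove K p => 𝒰.laHecke ℤ b' c' s' (heckeElement 2 K v.1 1) i')
    (fun v w => 𝒰.laHecke_comm h𝒰 ℤ b' c' s' (ht v) (ht w) i')
    (fun v w => 𝒰.laHecke_comm h𝒰 ℤ b c s (ht v) (ht w) i) Φ (fun v => hΦ _ (ht v)) hN hy

omit Φ in
/-- **If `N` kills the whole of `H^{i'}(U(b',c'), 1; ℤ/p^{s'})` then `LaKills (N z)` for every `z`.**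
[folklore] -/
theorem laKills_mul_C_of_forall_nsmul_eq_zero {N : ℕ} (hN : ∀ y : 𝒰.laCohomology ℤ b' c' s' i', N • y = 0)
    (z : MvPolynomial 𝒰.hidaElements ℤ) : 𝒰.LaKills b' c' s' i' (MvPolynomial.C (N : ℤ) * z) := by
  intro y _
  rw [map_mul, MvPolynomial.C_eq_coe_nat, map_natCast, Module.End.mul_apply, Module.End.natCast_apply, hN]

omit Φ in
/-- `LaKills (N z)` implies `LaKills (M z)` for `N ∣ M`. [folklore] -/
theorem laKills_mul_C_of_dvd {N M : ℕ} (hNM : N ∣ M) (z : MvPolynomial 𝒰.hidaElements ℤ)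
    (hz : 𝒰.LaKills b' c' s' i' (MvPolynomial.C (N : ℤ) * z)) :
    𝒰.LaKills b' c' s' i' (MvPolynomial.C (M : ℤ) * z) := by
  obtain ⟨d, rfl⟩ := hNM
  intro y hy
  have h := hz y hy
  rw [map_mul, MvPolynomial.C_eq_coe_nat, map_natCast, Module.End.mul_apply, Module.End.natCast_apply] at h ⊢
  rw [mul_comm, mul_nsmul, smul_comm, h, nsmul_zero]

omit Φ in
/-- `LaKills z` implies `LaKills (N z)`. [folklore] -/
theorem laKills_mul_C (N : ℕ) (z : MvPolynomial 𝒰.hidaElements ℤ) (hz : 𝒰.LaKills b' c' s' i' z) :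
    𝒰.LaKills b' c' s' i' (MvPolynomial.C (N : ℤ) * z) := by
  intro y hy
  rw [map_mul, Module.End.mul_apply, hz y hy, map_zero]

end Transport

end TameLevel

end BigHeckeGLn

end Literature.NumberTheory.Automorphic
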